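import Summits.AtomisticToContinuum.Crystallization.Theorems.ChartedZeroExcessLayeredLatticeLiouvilleZZZYE

/-!
# ChartedZeroExcess · LayeredLatticeLiouville ZZZYF (lens-2 g91 NODE 91 part 4 «JohnSynthesis») — THE KINEMATIC LEAF (SC♮′) PROVED at small coherence,
# and the door of record with it discharged (N4 of PLAN-g91-SC; critic rows 1613/1615/1618; docket stmt-AtomisticToContinuum-26636, W2 line).
★★★ `coherentZoneShadowCrystalP_of_le : ϑc ≤ ϑ₀ := 1/200000000000 (= 5·10⁻¹²) → CoherentZoneShadowCrystalP ϑc (1/10) 8 4 12 16 (27/32) (1/10000) 5 (1/10000) 10 (43/2) 1 2 (1/16) (1/50)`.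
PROOF (John synthesis of N2 «FrameKit» ZZZYC, N3a «WayPoints» ZZZYD, N3b «MoatRouting» ZZZYE).  Given the coherent fit `(Ψ, Q)` of the moat `M = moatIn S K 8 (8+12)`:
`H₀ := H = LayeredHom L w` (so `L′ := L`, `w′ := w`; clauses (ii) `IsSep (27/32) H` by `isSep_of_isClean`, (iii) self-shadow, from `isCoolShadowCrystal_self`);
`K = ∅`: `U := refl`, `t := 0`, (iv)/(v) vacuous.  `K ≠ ∅`: MASTER SITE `xs ∈ S` within `4/5` of `P₀ := x₀ + 14·canonTriple 0` (COV), a moat site (`13.2 ≤ dist(xs,x₀) ≤ 14.8`),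
`U := Q xs`, `t := xs − (Q xs)⁻¹(Ψ xs)` — so `xs` agrees at level `0` (`frame_read`) and `0 ≤ ϑc` (the fit at the bond `xs − xs`).  (iv) REG-OUT: a zone atom `p`
(`8 < dist p k ∀k`, `dist p k < 43/2 < 22.3 ∃k`) has an anchor `x ∈ M`, `dist p x ≤ 4`, agreeing at level `33212·541·ϑc` (`zone_agreement`); with the fit at the bond
`p − x` (`frame_label`) and `Ψ p ∈ H` (the `MapsTo` clause) `registered_of_read` places `p` within `(33212·541 + 1)ϑc = 17967693 ϑc ≤ 10⁻⁴` of the placed crystal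
(MARGIN: `17967693 · 5·10⁻¹² = 8.98·10⁻⁵`).  (v) REG-IN: a placed site `c` in the inner zone (`10 < dist c k`, `dist c k < 43/2`) has a COV atom `p′` within `4/5`,
which is a wide-zone atom (`> 9.2`, `< 22.3`), hence registered to a placed site `c′` within `10⁻⁴`; `dist c c′ < 4/5 + 10⁻⁴ < 27/32 = ` the placed separation
(`isSep_placedCrystal`) forces `c = c′`.
★★★★ `mildCoherentMoatCorePG_W2f : [MCMC♮](ϑc) ⟸ ϑc ≤ ϑ₀ ∧ (X1ᴸ′)(lam > 0) ∧ (X2ᴸ′) ∧ (DWᴹ′)(cE, 0)` (= `…_W2e_exactWell` with (SC♮′) discharged) and the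
`∃ ϑm > 0` hand-over `exists_mildCoherentMoatCorePG_W2f` (`ϑm := ϑ₀`; antitone dial `MildCoherentMoatCorePG.of_moat_le` for any smaller level).
RESIDUAL of the W2 line after this node: (X1ᴸ′), (X2ᴸ′), (DWᴹ′) at level `ϑ₀` — unchanged statements, no new residual.
BUDGET (r1619 (i)): `agreementBudget_eq` (33212·541 = 17967692), `registrationBudget_le` ((G+1)·ϑ₀ ≤ 1/10000 by `norm_num`), `registration_le_tol` (as consumed).
0 sorry · import = ZZZYE · 0 defs · no instances/notation/options · axioms standard. [g91]
-/

noncomputable section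

open scoped BigOperators RealInnerProductSpace
open MeasureTheory Set Metric Filter Topology
open Summit.AtomisticToContinuum.Crystallization.Theorems.ChartedPlanarOrderRigidityDoor (E3 IsClean atomsIn)
open Summit.AtomisticToContinuum.Crystallization.Theorems.ChartedPlanarOrderDensityDichotomy (μS IsSep)
open Summit.AtomisticToContinuum.Crystallization.Theorems.ChartedPlanarOrderCleanScaleP (IsCleanP IsDoorSetP)
open Summit.AtomisticToContinuum.Crystallization.Theorems.ChartedPlanarOrderMesoCut (LayeredHom EnvClose)
open Summit.AtomisticToContinuum.Crystallization.Theorems.ChartedPlanarOrderDoorLayeredOsc (IsTwoShellAffineGood)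
open Literature.Geometry.DiscreteGeometry (IsTwoShellGoodSet)
open Literature.MathematicalPhysics.StatisticalMechanics (lennardJones)

namespace Summit.AtomisticToContinuum.Crystallization.Theorems.ChartedZeroExcessLayeredLatticeLiouville

section Budget

/-- THE AGREEMENT BUDGET `G` (r1619 (i), explicit rationals): total hops × per-hop loss = `(28100 + 5100 + 12)·(1 + 20·27) = 33212·541 = 17967692`
(sphere walk: 281 way-points × ≤ 100 hops; ray walk: 51 × ≤ 100; K-descent: ≤ 12; per-hop loss `agree_hop` at reading radius `R = 27`). [g91] -/
theorem agreementBudget_eq : ((28100 + 5100 + 12) * (1 + 20 * 27) : ℝ) = 17967692 := by norm_num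

/-- THE REGISTRATION MARGIN AT `ϑ₀ = 1/200000000000 = 5·10⁻¹²` (r1619 (i)): `(G + 1)·ϑ₀ = 17967693·5·10⁻¹² = 8.98…·10⁻⁵ ≤ 1/10000 =` the consumer's tolerance —
the registration radius `ε` (8th parameter `ε := 1/10000` of `CoherentZoneShadowCrystalP`, i.e. of `IsCoolShadowCrystal σ ϑr Rs ε …` clauses (iv)/(v)) as
instantiated in the hypothesis `hSC` of the door of record `mildCoherentMoatCorePG_W2e_exactWell`; the `+1` is the coherent fit at the last bond `p − x`. [g91] -/
theorem registrationBudget_le : ((17967692 + 1) * (1 / 200000000000) : ℝ) ≤ 1 / 10000 := by norm_num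

/-- the margin as used: agreement `≤ 0 + 33212·ϑc·(1 + 20·27)` at the anchor plus one fit `≤ ϑc`, for `ϑc ≤ ϑ₀`, is within the tolerance `1/10000`. [g91] -/
theorem registration_le_tol {ϑc d₁ d₂ d : ℝ} (hϑc : ϑc ≤ 1 / 200000000000) (h₁ : d₁ ≤ 0 + 33212 * (ϑc * (1 + 20 * 27)))
    (h₂ : d₂ ≤ ϑc) (hd : d ≤ d₁ + d₂) : d ≤ 1 / 10000 := by
  have hG := agreementBudget_eq
  have hM := registrationBudget_le
  linarith

end Budget

section John

/-- ★★★ **THE KINEMATIC LEAF (SC♮′) PROVED AT SMALL COHERENCE**: for every `ϑc ≤ ϑ₀ := 1/200000000000` (`= 5·10⁻¹²`),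
`CoherentZoneShadowCrystalP ϑc (1/10) 8 4 12 16 (27/32) (1/10000) 5 (1/10000) 10 (43/2) 1 2 (1/16) (1/50)` — with `H₀ := H`, `U := Q xs`,
`t := xs − (Q xs)⁻¹ (Ψ xs)` at a master moat site `xs` (John synthesis of ZZZYC/ZZZYD/ZZZYE; constants: agreement `33212·541·ϑc`, registration
`17967693·ϑc ≤ 10⁻⁴`). [g91] -/
theorem coherentZoneShadowCrystalP_of_le {ϑc : ℝ} (hϑc : ϑc ≤ 1 / 200000000000) :
    CoherentZoneShadowCrystalP ϑc (1 / 10) 8 4 12 16 (27 / 32) (1 / 10000) 5 (1 / 10000) 10 (43 / 2) 1 2 (1 / 16) (1 / 50) := by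
  intro δ hδ a ha S hS hsum haff L w hLw x₀ K hKS hK hmild hcoh
  have h20 : (8 : ℝ) + 12 = 20 := by norm_num
  rw [h20] at hcoh
  have hsepS : IsSep (27 / 32) S := isSep_of_isDoorSetP le_rfl hS
  have hgood : ∀ q ∈ S, IsTwoShellGoodSet (1 / 16) (9 / 10) 1 S q := fun q hq => isTwoShellGoodSet_of_isDoorSetP hS hq
  have hsepH : IsSep (27 / 32) (LayeredHom (L : E3 →L[ℝ] E3) w) := isSep_of_isClean hLw.2.2.2.1
  have hself := isCoolShadowCrystal_self (K := K) (Rs := 5) (r := 8) (rI := 10) (ℓ := 43 / 2) hsepH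
    (by norm_num : (0 : ℝ) ≤ 1 / 10000) (by norm_num : (0 : ℝ) ≤ 1 / 10000)
  by_cases hKne : K.Nonempty
  swap
  · -- `K = ∅`: the crystal itself, read by the identity; the two registration clauses are vacuous.
    rw [Set.not_nonempty_iff_eq_empty] at hKne
    refine ⟨(L : E3 →L[ℝ] E3), w, LinearIsometryEquiv.refl ℝ E3, 0, hself.1, hself.2.1, hself.2.2.1, ?_, ?_⟩
    · rintro p - ⟨k, hk, -⟩ -
      simp [hKne] at hk
    · rintro c - ⟨k, hk, -⟩ -
      simp [hKne] at hk
  -- `K ≠ ∅`: the master site and its frame.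
  obtain ⟨Ψ, Qr, hdet, hmaps, hfit⟩ := hcoh
  obtain ⟨P₀, hP₀_def⟩ : ∃ P₀ : E3, P₀ = x₀ + (14 : ℝ) • canonTriple 0 := ⟨_, rfl⟩
  have hP₀ : dist P₀ x₀ = 14 := by
    rw [hP₀_def, dist_eq_norm, add_sub_cancel_left, norm_smul, norm_canonTriple, mul_one, Real.norm_of_nonneg (by norm_num : (0 : ℝ) ≤ 14)]
  obtain ⟨xs, hxs, hxsP⟩ := exists_mem_dist_lt_four_fifths (by norm_num : (0 : ℝ) < 27 / 32) hsepS hgood ⟨0, hS.1⟩ P₀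
  have hxsM : xs ∈ moatIn S K 8 20 :=
    mem_moatIn_of_shell hK hKne hxs (by linarith [dist_triangle P₀ xs x₀, dist_comm P₀ xs]) (by linarith [dist_triangle xs P₀ x₀])
  have hϑ0 : 0 ≤ ϑc := by
    have h := hfit xs hxsM xs hxs (by rw [dist_self]; norm_num)
    rwa [sub_self, map_zero, sub_self, dist_self] at h
  have hAG0 : ∀ v : E3, dist v x₀ ≤ 27 → dist ((Qr xs) (v - (xs - (Qr xs).symm (Ψ xs)))) (Ψ xs + (Qr xs) (v - xs)) ≤ 0 := fun v _ => by
    rw [frame_read, dist_self]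
  have hxsP1 : dist xs P₀ ≤ 1 := hxsP.le.trans (by norm_num)
  refine ⟨(L : E3 →L[ℝ] E3), w, Qr xs, xs - (Qr xs).symm (Ψ xs), hdet xs hxsM, hself.2.1, hself.2.2.1, ?_, ?_⟩
  · -- (iv) REG-OUT on the zone `8 < dist(·, K)`, `dist(·, K) < 43/2`.
    rintro p hp ⟨k, hk, hpk⟩ hplo
    obtain ⟨x, hxM, hpx, hAG⟩ := zone_agreement hϑ0 hfit hgood hsepS hK hP₀ hxs hxsP1 hAG0 hp hplo ⟨k, hk, by linarith⟩
    have hpR : dist p x₀ ≤ 27 := by linarith [dist_triangle p k x₀, hK k hk]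
    have h1 := hAG p hpR
    have h2 : dist (Ψ x + (Qr x) (p - x)) (Ψ p) ≤ ϑc := by rw [frame_label]; exact hfit x hxM p hp hpx
    have hΨp : Ψ p ∈ LayeredHom (L : E3 →L[ℝ] E3) w := hmaps x hxM ⟨hp, mem_closedBall.2 hpx⟩
    exact registered_of_read (Qr xs) _ hΨp
      (registration_le_tol hϑc h1 h2 (dist_triangle ((Qr xs) (p - (xs - (Qr xs).symm (Ψ xs)))) (Ψ x + (Qr x) (p - x)) (Ψ p)))
  · -- (v) REG-IN on the zone `10 < dist(·, K)`, `dist(·, K) < 43/2`: a COV atom `p'` within `4/5` of the placed site `c` is registered; separation closes.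
    rintro c hc ⟨k, hk, hck⟩ hclo
    obtain ⟨p', hp', hp'c⟩ := exists_mem_dist_lt_four_fifths (by norm_num : (0 : ℝ) < 27 / 32) hsepS hgood ⟨0, hS.1⟩ c
    have hplo : ∀ k ∈ K, 8 < dist p' k := fun k hk => by linarith [hclo k hk, dist_triangle c p' k, dist_comm c p']
    have hphi : ∃ k ∈ K, dist p' k < 223 / 10 := ⟨k, hk, by linarith [dist_triangle p' c k]⟩
    obtain ⟨x, hxM, hpx, hAG⟩ := zone_agreement hϑ0 hfit hgood hsepS hK hP₀ hxs hxsP1 hAG0 hp' hplo hphi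
    have hpR : dist p' x₀ ≤ 27 := by linarith [dist_triangle p' k x₀, hK k hk, dist_triangle p' c k]
    have h1 := hAG p' hpR
    have h2 : dist (Ψ x + (Qr x) (p' - x)) (Ψ p') ≤ ϑc := by rw [frame_label]; exact hfit x hxM p' hp' hpx
    have hΨp : Ψ p' ∈ LayeredHom (L : E3 →L[ℝ] E3) w := hmaps x hxM ⟨hp', mem_closedBall.2 hpx⟩
    have hd : dist ((Qr xs) (p' - (xs - (Qr xs).symm (Ψ xs)))) (Ψ p') ≤ 1 / 10000 :=
      registration_le_tol hϑc h1 h2 (dist_triangle ((Qr xs) (p' - (xs - (Qr xs).symm (Ψ xs)))) (Ψ x + (Qr x) (p' - x)) (Ψ p'))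
    obtain ⟨c', hc', hp'c'⟩ := registered_of_read (Qr xs) (xs - (Qr xs).symm (Ψ xs)) hΨp hd
    have hsepC := isSep_placedCrystal (Qr xs) (xs - (Qr xs).symm (Ψ xs)) hsepH
    have hcc' : c = c' := by
      by_contra hne
      have h27 := hsepC c hc c' hc' hne
      linarith [dist_triangle c p' c', dist_comm c p', four_fifths_add_eps_lt_hardCore]
    exact ⟨p', hp', by rw [hcc']; exact hp'c'⟩

/-- ★★★★ **THE DOOR OF RECORD WITH (SC♮′) DISCHARGED — `[MCMC♮](ϑc) ⟸ ϑc ≤ ϑ₀ ∧ (X1ᴸ′)(lam > 0) ∧ (X2ᴸ′) ∧ (DWᴹ′)(cE, 0)`** (`ϑ₀ = 1/200000000000`;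
`mildCoherentMoatCorePG_W2e_exactWell` ∘ `coherentZoneShadowCrystalP_of_le`). [g91] -/
theorem mildCoherentMoatCorePG_W2f {ϑc sb₁ dI₁ dB₁ lam cE : ℝ} (hϑc : ϑc ≤ 1 / 200000000000) (hlam : 0 < lam) (hcE : 0 < cE)
    (hsb : 4 * sb₁ ≤ 249 / 5000) (hdI : 4 * dI₁ ≤ 249 / 5000) (hdB : dB₁ ≤ 2 / 5) (hsb₀ : 0 ≤ sb₁) (hdI₀ : 0 ≤ dI₁) (hdB₀ : 0 ≤ dB₁)
    (hX1 : LabelTubeConvexityP ϑc tameRadius (1 / 10) 8 (145 / 16) 4 12 16 16 (27 / 32) (1 / 10000) 5 (1 / 10000) 10 (43 / 2) (1 / 5000) (121 / 25)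
      (249 / 5000) (249 / 5000) (21 / 50) lam 1 2 (1 / 16) (1 / 50))
    (hX2 : LabelLoadedTubeAprioriP ϑc tameRadius (1 / 10) 8 (145 / 16) 4 12 16 16 (27 / 32) (1 / 10000) 5 (1 / 10000) 10 (43 / 2) (1 / 5000)
      (121 / 25) (249 / 5000) (249 / 5000) (21 / 50) sb₁ dI₁ dB₁ 1 2 (1 / 16) (1 / 50))
    (hDW : DeficitWellMinP ϑc tameRadius (1 / 10) 8 (145 / 16) 4 12 16 16 (27 / 32) (1 / 10000) 5 (1 / 10000) 10 (43 / 2) (121 / 25) sb₁ dI₁ dB₁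
      (121 / 25) cE 0 1 2 (1 / 16) (1 / 50)) :
    MildCoherentMoatCorePG ϑc tameRadius (1 / 10) 8 4 12 16 1 2 (1 / 16) (1 / 50) :=
  mildCoherentMoatCorePG_W2e_exactWell hlam hcE hsb hdI hdB hsb₀ hdI₀ hdB₀ (coherentZoneShadowCrystalP_of_le hϑc) hX1 hX2 hDW

/-- ★★ **THE `∃ ϑm` HAND-OVER**: the three residual leaves at level `ϑ₀ = 1/200000000000` give `∃ ϑm > 0, [MCMC♮](ϑm)` (`ϑm := ϑ₀`; any smaller level by the
antitone dial `MildCoherentMoatCorePG.of_moat_le`). [g91] -/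
theorem exists_mildCoherentMoatCorePG_W2f {sb₁ dI₁ dB₁ lam cE : ℝ} (hlam : 0 < lam) (hcE : 0 < cE) (hsb : 4 * sb₁ ≤ 249 / 5000)
    (hdI : 4 * dI₁ ≤ 249 / 5000) (hdB : dB₁ ≤ 2 / 5) (hsb₀ : 0 ≤ sb₁) (hdI₀ : 0 ≤ dI₁) (hdB₀ : 0 ≤ dB₁)
    (hX1 : LabelTubeConvexityP (1 / 200000000000) tameRadius (1 / 10) 8 (145 / 16) 4 12 16 16 (27 / 32) (1 / 10000) 5 (1 / 10000) 10 (43 / 2)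
      (1 / 5000) (121 / 25) (249 / 5000) (249 / 5000) (21 / 50) lam 1 2 (1 / 16) (1 / 50))
    (hX2 : LabelLoadedTubeAprioriP (1 / 200000000000) tameRadius (1 / 10) 8 (145 / 16) 4 12 16 16 (27 / 32) (1 / 10000) 5 (1 / 10000) 10 (43 / 2)
      (1 / 5000) (121 / 25) (249 / 5000) (249 / 5000) (21 / 50) sb₁ dI₁ dB₁ 1 2 (1 / 16) (1 / 50))
    (hDW : DeficitWellMinP (1 / 200000000000) tameRadius (1 / 10) 8 (145 / 16) 4 12 16 16 (27 / 32) (1 / 10000) 5 (1 / 10000) 10 (43 / 2)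
      (121 / 25) sb₁ dI₁ dB₁ (121 / 25) cE 0 1 2 (1 / 16) (1 / 50)) :
    ∃ ϑm : ℝ, 0 < ϑm ∧ MildCoherentMoatCorePG ϑm tameRadius (1 / 10) 8 4 12 16 1 2 (1 / 16) (1 / 50) :=
  ⟨1 / 200000000000, by norm_num, mildCoherentMoatCorePG_W2f le_rfl hlam hcE hsb hdI hdB hsb₀ hdI₀ hdB₀ hX1 hX2 hDW⟩

end John

end Summit.AtomisticToContinuum.Crystallization.Theorems.ChartedZeroExcessLayeredLatticeLiouville

end
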